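import Literature.NumberTheory.LFunctions.WeilChirpDecay
import HarnessLib

/-!
# Smooth kernels for the remainder of the chirped Euler–Maclaurin formula (Weil side)

For a chirp phase `φ` (`ChirpPhase φ H L Cφ`) with Nyquist margin `L = log 3/(2π) + δ`,
`δ > 0`, and a Weil test function `G` supported in the window `[-log 3, log 3]`, every piece
of the remainder of the second-order Euler–Maclaurin formula along the level set of `φ`
applied to `F(t) = Ĝ(1/2 + it)` is of the form `∫ G(x) K(x) dx` with `K` smooth and
independent of `G`:
* the aliased far pieces `∫_{t>H} F ρ_H w (P(φ) + 1/12)` for the weights `w = 1/φ'` and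
  `w = φ''/φ'²` (`exists_weil_alias_kernel_inv_deriv`, `exists_weil_alias_kernel_curv`; the
  alias expansion `exists_kernel_alias_expansion` of `ChirpAliasExpansion.lean` with the cut-off
  `χ = 1` on the window, supported in `|x| ≤ log 3 + πδ < 2πL`);
* the near pieces `∫_{t>H} F (1 - ρ_H) w P(φ)` and the boundary piece `∫_{t>H} ρ_H' F/φ'`
  (`exists_weil_near_kernel`, compact `t`-range).
Sources: Stein, *Harmonic Analysis* (1993), VIII §1; Olver (1974), Ch. 8. Everything is proved;
no definitions, no named facts.
-/

noncomputable section

open Complex Filter Set MeasureTheory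
open scoped Real Topology ContDiff
open Literature.Analysis.Fourier

namespace Literature.NumberTheory.LFunctions

/-! ## A smooth cut-off equal to one on the window -/

/-- A smooth `χ : ℝ → ℂ` with `χ = 1` on `[-a, a]` and `tsupport χ ⊆ [-c', c']` (`0 < a < c'`;
Mathlib's `ContDiffBump`). [folklore] -/
theorem exists_smooth_cutoff {a c' : ℝ} (ha : 0 < a) (hac : a < c') :
    ∃ χ : ℝ → ℂ, ContDiff ℝ ∞ χ ∧ tsupport χ ⊆ Icc (-c') c' ∧ ∀ x ∈ Icc (-a) a, χ x = 1 := by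
  let B : ContDiffBump (0 : ℝ) := ⟨a, c', ha, hac⟩
  refine ⟨fun x => ((B x : ℝ) : ℂ), ofRealCLM.contDiff.comp B.contDiff, ?_, fun x hx => ?_⟩
  · have hs : Function.support (fun x => ((B x : ℝ) : ℂ)) = Function.support B := by
      ext x; simp
    have : tsupport (fun x => ((B x : ℝ) : ℂ)) = tsupport B := by
      simp only [tsupport, hs]
    rw [this, B.tsupport_eq, Real.closedBall_eq_Icc, zero_sub, zero_add]
  · have hx' : x ∈ Metric.closedBall (0 : ℝ) a := by
      rw [Real.closedBall_eq_Icc, zero_sub, zero_add]; exact hx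
    simp [B.one_of_mem_closedBall hx']

/-! ## The far (aliased) kernels -/

section Far

variable {φ : ℝ → ℝ} {H L δ : ℝ} {Cφ : ℕ → ℝ} (hφ : ChirpPhase φ H L Cφ) (hδ : 0 < δ)
  (hL : L = Real.log 3 / (2 * π) + δ)

include hφ hδ hL in
/-- **Far kernel for a general weight.** For a weight `w` (continuous, smooth on `(H, ∞)`,
uniform symbol of order `0`, bounded on `(H, ∞)`) there is a smooth `K` with
`∫_{t>H} Ĝ(1/2+it) ρ_H(t) w(t) (P(φ(t)) + 1/12) dt = ∫ G K` for every Weil test `G`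
supported in `[-log 3, log 3]`. [folklore] -/
theorem exists_weil_alias_kernel {w : ℝ → ℝ} (hwc : Continuous w)
    (hws : ContDiffOn ℝ ∞ w (Ioi H)) (hwb : ∀ R, SymBnd (univ : Set Unit) H 0 R (fun _ => w))
    {B : ℝ} (hB : 0 ≤ B) (hwB : ∀ t, H < t → |w t| ≤ B) :
    ∃ K : ℝ → ℂ, ContDiff ℝ ∞ K ∧ ∀ G : ℝ → ℂ, IsWeilTest G →
      tsupport G ⊆ Icc (-Real.log 3) (Real.log 3) →
      ∫ t in Ioi H, weilMellin G (1 / 2 + t * I) * ((rhoCut H t * w t : ℝ) : ℂ) *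
        ((perB2 (φ t) + 1 / 12 : ℝ) : ℂ) = ∫ x, G x * K x := by
  have ha : 0 < Real.log 3 := Real.log_pos (by norm_num)
  set c' : ℝ := Real.log 3 + π * δ with hc'
  have hac : Real.log 3 < c' := by rw [hc']; linarith [mul_pos Real.pi_pos hδ]
  have hc'0 : 0 ≤ c' := by linarith
  have hcL : c' < 2 * π * L := by
    rw [hL, hc', mul_add, mul_div_cancel₀ _ (by positivity : (2 * π : ℝ) ≠ 0)]
    linarith [mul_pos Real.pi_pos hδ]
  obtain ⟨χ, hχ, hχs, hχ1⟩ := exists_smooth_cutoff ha hac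
  obtain ⟨K, hK, hKid⟩ := exists_kernel_alias_expansion hφ hwc hws hwb hc'0 hcL hχ hχs hac.le hχ1
  refine ⟨K, hK, fun G hG hGa => ?_⟩
  have hint : IntegrableOn (fun τ => (∫ x, G x * cexp (((x * τ : ℝ) : ℂ) * I)) * (w τ : ℂ))
      (Ioi H) := by
    have := integrableOn_weilMellin_line_mul hG hwc.continuousOn
      (fun t ht => le_mul_one_add_sq hB (hwB t ht)) (H := H)
    refine this.congr_fun (fun τ _ => ?_) measurableSet_Ioi
    simp only [weilMellin_half_eq_integral]
  have := hKid G hG.1.continuous hG.2 hGa hint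
  simp_rw [weilMellin_half_eq_integral]
  exact this

include hφ hδ hL in
/-- **Far kernel, weight `1/φ'`.** [folklore] -/
theorem exists_weil_alias_kernel_inv_deriv :
    ∃ K : ℝ → ℂ, ContDiff ℝ ∞ K ∧ ∀ G : ℝ → ℂ, IsWeilTest G →
      tsupport G ⊆ Icc (-Real.log 3) (Real.log 3) →
      ∫ t in Ioi H, weilMellin G (1 / 2 + t * I) * ((rhoCut H t * (deriv φ t)⁻¹ : ℝ) : ℂ) *
        ((perB2 (φ t) + 1 / 12 : ℝ) : ℂ) = ∫ x, G x * K x := by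
  obtain ⟨hvc, hvb, hveq⟩ := chirpPhase_invSlope_props hφ
  have hvs : ContDiffOn ℝ ∞ (fun t => (max (deriv φ t) L)⁻¹) (Ioi H) :=
    hφ.contDiffOn_inv_deriv.congr fun t ht => hveq t (le_of_lt ht)
  have hvsb : ∀ R, SymBnd (univ : Set Unit) H 0 R (fun _ t => (max (deriv φ t) L)⁻¹) :=
    fun R => (hφ.symBnd_inv_deriv univ R).congr fun _ _ t ht => (hveq t (le_of_lt ht)).symm
  obtain ⟨K, hK, hKid⟩ := exists_weil_alias_kernel hφ hδ hL hvc hvs hvsb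
    (inv_nonneg.mpr hφ.pos.le) (fun t _ => hvb t)
  refine ⟨K, hK, fun G hG hGa => ?_⟩
  rw [← hKid G hG hGa]
  refine setIntegral_congr_fun measurableSet_Ioi fun t ht => ?_
  simp only [hveq t (le_of_lt ht)]

include hφ hδ hL in
/-- **Far kernel, weight `φ''/φ'²`.** [folklore] -/
theorem exists_weil_alias_kernel_curv :
    ∃ K : ℝ → ℂ, ContDiff ℝ ∞ K ∧ ∀ G : ℝ → ℂ, IsWeilTest G →
      tsupport G ⊆ Icc (-Real.log 3) (Real.log 3) →
      ∫ t in Ioi H, weilMellin G (1 / 2 + t * I) *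
        ((rhoCut H t * (deriv (deriv φ) t * (deriv φ t)⁻¹ * (deriv φ t)⁻¹) : ℝ) : ℂ) *
        ((perB2 (φ t) + 1 / 12 : ℝ) : ℂ) = ∫ x, G x * K x := by
  obtain ⟨_, _, hveq⟩ := chirpPhase_invSlope_props hφ
  obtain ⟨hwc, hwb, hweq⟩ := chirpPhase_curvWeight_props hφ
  have hne : ∀ t, H < t → deriv φ t ≠ 0 := fun t ht =>
    (hφ.pos.trans_le (hφ.deriv_ge t ht.le)).ne'
  have h2 : ContDiff ℝ ∞ (deriv (deriv φ)) := (contDiff_infty_iff_deriv.1 hφ.contDiff_deriv).2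
  have hws : ContDiffOn ℝ ∞
      (fun t => deriv (deriv φ) t * (max (deriv φ t) L)⁻¹ * (max (deriv φ t) L)⁻¹) (Ioi H) :=
    ((h2.contDiffOn.mul hφ.contDiffOn_inv_deriv).mul hφ.contDiffOn_inv_deriv).congr
      fun t ht => hweq t (le_of_lt ht)
  have hwsb : ∀ R, SymBnd (univ : Set Unit) H 0 R
      (fun _ t => deriv (deriv φ) t * (max (deriv φ t) L)⁻¹ * (max (deriv φ t) L)⁻¹) :=
    fun R => ((hφ.symBnd_deriv_deriv_div univ R).mono_order hφ.one_le (by norm_num)).congr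
      fun _ _ t ht => (hweq t (le_of_lt ht)).symm
  have hB : 0 ≤ 2 * max (Cφ 2) 0 * L⁻¹ * L⁻¹ := by
    have := inv_nonneg.mpr hφ.pos.le; positivity
  obtain ⟨K, hK, hKid⟩ := exists_weil_alias_kernel hφ hδ hL hwc hws hwsb hB
    (fun t ht => hwb t ht.le)
  refine ⟨K, hK, fun G hG hGa => ?_⟩
  rw [← hKid G hG hGa]
  refine setIntegral_congr_fun measurableSet_Ioi fun t ht => ?_
  simp only [hweq t (le_of_lt ht)]

end Far

/-! ## The near kernels and the boundary kernel -/

/-- `ρ_H'` vanishes off `[H + 1/4, H + 1/2]`. [folklore] -/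
theorem deriv_rhoCut_eq_zero {H t : ℝ} (ht : t < H + 1 / 4 ∨ H + 1 / 2 < t) :
    deriv (rhoCut H) t = 0 := by
  rcases ht with ht | ht
  · have : rhoCut H =ᶠ[𝓝 t] fun _ => (0 : ℝ) := by
      filter_upwards [Iio_mem_nhds ht] with s hs using rhoCut_eq_zero hs.le
    rw [this.deriv_eq, deriv_const]
  · have : rhoCut H =ᶠ[𝓝 t] fun _ => (1 : ℝ) := by
      filter_upwards [Ioi_mem_nhds ht] with s hs using rhoCut_eq_one hs.le
    rw [this.deriv_eq, deriv_const]

/-- **Near kernel for a general amplitude.** For `f` continuous on `[H, ∞)` with `f(H) = 0`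
and `f = 0` beyond `R` there is a smooth `N` with `∫_{t>H} Ĝ(1/2+it) f(t) dt = ∫ G N` for every
continuous compactly supported `G`. [folklore] -/
theorem exists_weil_near_kernel {φ : ℝ → ℝ} (hφc : Continuous φ) {H : ℝ} {f : ℝ → ℝ}
    (hf : ContinuousOn f (Ici H)) (h0 : f H = 0) {R : ℝ} (hR : ∀ τ, R < τ → f τ = 0) :
    ∃ N : ℝ → ℂ, ContDiff ℝ ∞ N ∧ ∀ G : ℝ → ℂ, Continuous G → HasCompactSupport G →
      ∫ t in Ioi H, weilMellin G (1 / 2 + t * I) * (f t : ℂ) = ∫ x, G x * N x := by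
  refine ⟨aliasKT φ (H - 1) (cutBelow H f) 0, contDiff_aliasKT_cutBelow hφc hf h0 hR,
    fun G hG hGs => ?_⟩
  simp_rw [weilMellin_half_eq_integral]
  exact integral_ft_mul_eq_integral_mul_aliasKT_cutBelow hφc hf h0 hR hG hGs

section Near

variable {φ : ℝ → ℝ} {H L : ℝ} {Cφ : ℕ → ℝ} (hφ : ChirpPhase φ H L Cφ) (hφH : φ H = 0)

include hφ hφH in
/-- **Near kernel, weight `1/φ'`**: `∫_{t>H} Ĝ (1 - ρ_H) P(φ)/φ' = ∫ G N`. [folklore] -/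
theorem exists_weil_near_kernel_inv_deriv :
    ∃ N : ℝ → ℂ, ContDiff ℝ ∞ N ∧ ∀ G : ℝ → ℂ, Continuous G → HasCompactSupport G →
      ∫ t in Ioi H, weilMellin G (1 / 2 + t * I) *
        (((1 - rhoCut H t) * (deriv φ t)⁻¹ * perB2 (φ t) : ℝ) : ℂ) = ∫ x, G x * N x := by
  have hne : ∀ t ∈ Ici H, deriv φ t ≠ 0 := fun t ht => (hφ.pos.trans_le (hφ.deriv_ge t ht)).ne'
  refine exists_weil_near_kernel hφ.smooth.continuous (R := H + 1 / 2) ?_ ?_ ?_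
  · exact ((continuous_const.sub (contDiff_rhoCut H).continuous).continuousOn.mul
      (hφ.contDiff_deriv.continuous.continuousOn.inv₀ hne)).mul
      (continuous_perB2.comp hφ.smooth.continuous).continuousOn
  · simp [hφH, perB2_zero]
  · intro τ hτ
    simp [rhoCut_eq_one hτ.le]

include hφ hφH in
/-- **Near kernel, weight `φ''/φ'²`**: `∫_{t>H} Ĝ (1 - ρ_H) P(φ) φ''/φ'² = ∫ G N`. [folklore] -/
theorem exists_weil_near_kernel_curv :
    ∃ N : ℝ → ℂ, ContDiff ℝ ∞ N ∧ ∀ G : ℝ → ℂ, Continuous G → HasCompactSupport G →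
      ∫ t in Ioi H, weilMellin G (1 / 2 + t * I) *
        (((1 - rhoCut H t) * (deriv (deriv φ) t * (deriv φ t)⁻¹ * (deriv φ t)⁻¹) *
          perB2 (φ t) : ℝ) : ℂ) = ∫ x, G x * N x := by
  have hne : ∀ t ∈ Ici H, deriv φ t ≠ 0 := fun t ht => (hφ.pos.trans_le (hφ.deriv_ge t ht)).ne'
  have h2 : Continuous (deriv (deriv φ)) :=
    (contDiff_infty_iff_deriv.1 hφ.contDiff_deriv).2.continuous
  have hi := hφ.contDiff_deriv.continuous.continuousOn.inv₀ hne
  refine exists_weil_near_kernel hφ.smooth.continuous (R := H + 1 / 2) ?_ ?_ ?_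
  · exact ((continuous_const.sub (contDiff_rhoCut H).continuous).continuousOn.mul
      ((h2.continuousOn.mul hi).mul hi)).mul
      (continuous_perB2.comp hφ.smooth.continuous).continuousOn
  · simp [hφH, perB2_zero]
  · intro τ hτ
    simp [rhoCut_eq_one hτ.le]

include hφ in
/-- **Boundary kernel**: `∫_{t>H} (ρ_H' /φ') Ĝ = ∫ G Z`. [folklore] -/
theorem exists_weil_zero_kernel :
    ∃ Z : ℝ → ℂ, ContDiff ℝ ∞ Z ∧ ∀ G : ℝ → ℂ, Continuous G → HasCompactSupport G →
      ∫ t in Ioi H, ((deriv (rhoCut H) t * (deriv φ t)⁻¹ : ℝ) : ℂ) *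
        weilMellin G (1 / 2 + t * I) = ∫ x, G x * Z x := by
  have hne : ∀ t ∈ Ici H, deriv φ t ≠ 0 := fun t ht => (hφ.pos.trans_le (hφ.deriv_ge t ht)).ne'
  have hρ'c : Continuous (deriv (rhoCut H)) :=
    (contDiff_infty_iff_deriv.1 (contDiff_rhoCut H)).2.continuous
  obtain ⟨Z, hZ, hZid⟩ := exists_weil_near_kernel hφ.smooth.continuous (H := H) (R := H + 1 / 2)
    (f := fun t => deriv (rhoCut H) t * (deriv φ t)⁻¹)
    (hρ'c.continuousOn.mul (hφ.contDiff_deriv.continuous.continuousOn.inv₀ hne))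
    (by simp [deriv_rhoCut_eq_zero (H := H) (t := H) (Or.inl (by linarith))])
    (fun τ hτ => by simp [deriv_rhoCut_eq_zero (Or.inr hτ)])
  refine ⟨Z, hZ, fun G hG hGs => ?_⟩
  rw [← hZid G hG hGs]
  refine setIntegral_congr_fun measurableSet_Ioi fun t _ => ?_
  ring

end Near

end Literature.NumberTheory.LFunctions
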